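import Literature.IUT.LogVolume.TorsionPointsFactsProofs
import Mathlib.Algebra.Group.PUnit
import Mathlib.Algebra.Group.TypeTags.Finite
import Mathlib.Data.ZMod.Basic
import HarnessLib

/-!
# [IUTchIV] Prop. 1.8 over the interface `Prop18.TorsionSetting`: the named `Prop`s are SCHEMAS
# (instance-only facts) — kernel witnesses

`Literature.IUT.LogVolume.TorsionPointsFacts` (abc-iut-S2/S3) types S. Mochizuki, *Inter-universal
Teichmüller theory IV* (kurims Apr-2020 manuscript), Prop. 1.8 (i)–(vii) pp. 18–19, as `Prop`-valued
definitions `P18_i, …, P18_vii, P18` over a structure `TorsionSetting` that bundles the DATA named in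
the text (`G_k`, `Aut_k̄(E_k̄) ⊆ Aut_k(E_k̄) → G_k`, the torsion modules and representations `ρ_n`,
reduction-type predicates) and carries NO LAWS.  Consequently each `P18_*` is a SCHEMA: true at the
intended instances (elliptic curves over perfect fields — the REAL forms are the tree's
`WeierstrassCurve.VariableChange.eq_one_of_torsion_fixed` (i),
`WeierstrassCurve.exists_variableChange_of_torsion_fixed` (iv),
`WeierstrassCurve.isSemistableAt_of_forall_smul_geomTorsion_eq` (v),
`WeierstrassCurve.exists_legendre_j_eq_of_two_torsion_rational` (vi, first sentence)), but FALSE at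
degenerate instances of the lawless interface.  This file records that fact in the kernel, for the
cell's FACT-LIST bookkeeping (rows F-2258 `P18`, F-2259 `P18_i`, F-2260 `P18_v`, F-2261 `P18_vi`,
F-2262 `P18_vii` are consumable only AT A NAMED INSTANCE `S`, never as `∀ S, S.P18_*`):

* `Prop18.TorsionSetting.trivialSetting` with `trivialSetting_p18 : trivialSetting.P18` — the schema is
  SATISFIABLE (so it is a genuine schema, not a contradiction), hence `exists_p18 : ∃ S, S.P18`;
* `Prop18.TorsionSetting.kernelSetting` — `Aut_k̄(E_k̄) := ℤ/2` acting on a trivial torsion module, every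
  reduction predicate `False`: `not_forall_p18_i`, `not_forall_p18_v`, `not_forall_p18_vi`,
  `not_forall_p18`;
* `Prop18.TorsionSetting.signSetting` — "inertia" `ℤ/2` acting by `−1` on `ℤ/3` under a vacuous
  good-reduction predicate: `not_forall_p18_vii`.

Written by the cell `abc-iut` (seat abc-iut-w5-d157).  No bearing on [IUTchIII] Cor. 3.12; Prop. 1.8
is classical and its real forms are theorems of the tree — the point here is only the LOGICAL SHAPE
of the interface rows.

## References

* [Mochizuki2012] S. Mochizuki, IUT IV, Prop. 1.8 (i)–(vii) pp. 18–19 (kurims Apr-2020 manuscript).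
-/

namespace Literature.IUT.LogVolume

namespace Prop18

namespace TorsionSetting

/-- Two additive endomorphisms of the one-element group coincide.
[cite: Mochizuki2012, IUTchIV Prop 1.8 pp.18-19] -/
theorem addMonoidEnd_punit_eq (f g : AddMonoid.End PUnit.{1}) : f = g :=
  AddMonoidHom.ext fun _ => rfl

/-! ## A model: everything trivial (all seven clauses hold) -/

/-- The TRIVIAL instance of the interface: all groups and torsion modules are the one-element
group, every predicate is `True`.  All of (i)–(vii) hold here (`trivialSetting_p18`), so the schema
`P18` is satisfiable. [cite: Mochizuki2012, IUTchIV Prop 1.8 pp.18-19] -/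
abbrev trivialSetting : TorsionSetting where
  Gk := PUnit.{1}
  instGroupGk := inferInstance
  instTopGk := ⊥
  AutBar := PUnit.{1}
  instGroupAutBar := inferInstance
  AutK := PUnit.{1}
  instGroupAutK := inferInstance
  incl := MonoidHom.id _
  proj := MonoidHom.id _
  Tor := fun _ => PUnit.{1}
  instTor := fun _ => inferInstance
  ρ := fun _ => 1
  charUnitK := fun _ => True
  charUnitO := fun _ => True
  charUnitO_le := fun _ h => h
  Gj := ⊤
  inertia := ⊤
  wildInertia := ⊤
  wild_le := le_rfl
  SemistableReduction := fun _ _ => True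
  GoodReduction := fun _ _ => True
  MultiplicativeReduction := fun _ _ => True
  IsLegendre := fun _ => True

/-- `Nat.card` of the automorphism group of the trivial instance is `1`.
[cite: Mochizuki2012, IUTchIV Prop 1.8 pp.18-19] -/
theorem trivialSetting_card_autBar : Nat.card trivialSetting.AutBar = 1 := by
  simp

/-- **The schema `P18` is satisfiable**: all of [IUTchIV] Prop. 1.8 (i)–(vii), as typed over the
interface, hold in the trivial instance. [cite: Mochizuki2012, IUTchIV Prop 1.8 pp.18-19] -/
theorem trivialSetting_p18 : trivialSetting.P18 := by
  refine ⟨?_, ?_, ?_, ?_, ?_, ?_, ?_⟩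
  · -- (i): a map out of a one-element type is injective
    intro l _ _ _ a b _
    exact Subsingleton.elim a b
  · -- (ii)
    refine ⟨fun a b _ => Subsingleton.elim a b, Subsingleton.elim _ _, ?_, Subsingleton.elim _ _,
      ⟨⟨1, fun h => Subsingleton.elim _ _⟩⟩⟩
    exact @isOpen_discrete _ _ ⟨rfl⟩ _
  · -- (iii): `Nat.card PUnit = 1 ≠ 2`
    intro h
    rw [trivialSetting_card_autBar] at h
    exact absurd h (by norm_num)
  · -- (iv): `ModelIso` with `a = 1` in a one-element group
    intro l _ _ _ s s' _ _
    exact ⟨1, fun h => Subsingleton.elim _ _⟩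
  · -- (v)
    intro l _ _ _ s _
    trivial
  · -- (vi): `Nat.card PUnit = 1 ≠ 2`
    intro h
    rw [trivialSetting_card_autBar] at h
    exact absurd h (by norm_num)
  · -- (vii)
    intro n hn _ s
    refine ⟨fun _ g _ => addMonoidEnd_punit_eq _ _, fun _ => ⟨fun g _ => addMonoidEnd_punit_eq _ _, ?_⟩⟩
    have htop : (((trivialSetting.torsionAction s n).ker.map
        (⊤ : Subgroup trivialSetting.Gk).subtype).subgroupOf trivialSetting.inertia) = ⊤ :=
      Subsingleton.elim _ _
    rw [htop, Subgroup.index_top]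
    exact one_dvd n

/-- Hence `∃ S, S.P18`. [cite: Mochizuki2012, IUTchIV Prop 1.8 pp.18-19] -/
theorem exists_p18 : ∃ S : TorsionSetting, S.P18 := ⟨trivialSetting, trivialSetting_p18⟩

/-! ## A counter-instance for (i), (v), (vi): `Aut_k̄(E_k̄) = ℤ/2` acting on a trivial torsion module -/

/-- A DEGENERATE instance of the lawless interface: `G_k = 1`, `Aut_k̄(E_k̄) = Aut_k(E_k̄) = ℤ/2`, all
torsion modules trivial (so every `ρ_n` is trivial and "Serre's criterion" fails), and the
reduction / Legendre predicates identically `False`. [cite: Mochizuki2012, IUTchIV Prop 1.8 pp.18-19] -/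
abbrev kernelSetting : TorsionSetting where
  Gk := PUnit.{1}
  instGroupGk := inferInstance
  instTopGk := ⊥
  AutBar := Multiplicative (ZMod 2)
  instGroupAutBar := inferInstance
  AutK := Multiplicative (ZMod 2)
  instGroupAutK := inferInstance
  incl := MonoidHom.id _
  proj := 1
  Tor := fun _ => PUnit.{1}
  instTor := fun _ => inferInstance
  ρ := fun _ => 1
  charUnitK := fun _ => True
  charUnitO := fun _ => True
  charUnitO_le := fun _ h => h
  Gj := ⊤
  inertia := ⊤
  wildInertia := ⊤
  wild_le := le_rfl
  SemistableReduction := fun _ _ => False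
  GoodReduction := fun _ _ => False
  MultiplicativeReduction := fun _ _ => False
  IsLegendre := fun _ => False

/-- The trivial homomorphism `1 = G_k → Aut_k(E_k̄)` is a model over `k` (a section over `⊤`) in
`kernelSetting`. [cite: Mochizuki2012, IUTchIV Prop 1.8 pp.18-19] -/
def kernelSetting.model : kernelSetting.Model ⊤ := ⟨1, fun _ => Subsingleton.elim _ _⟩

/-- All the `l`-torsion of `kernelSetting.model` is "rational" (the torsion modules are trivial).
[cite: Mochizuki2012, IUTchIV Prop 1.8 pp.18-19] -/
theorem kernelSetting.torsionRational (l : ℕ) : kernelSetting.TorsionRational kernelSetting.model l :=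
  fun _ => addMonoidEnd_punit_eq _ _

/-- `Nat.card` of the automorphism group `ℤ/2` of `kernelSetting` is `2`.
[cite: Mochizuki2012, IUTchIV Prop 1.8 pp.18-19] -/
theorem kernelSetting_card_autBar : Nat.card kernelSetting.AutBar = 2 := by
  simp [Nat.card_eq_fintype_card]

/-- **(i) is false at `kernelSetting`**: `ρ_3 ∘ incl : ℤ/2 → End(0)` is not injective.
[cite: Mochizuki2012, IUTchIV Prop 1.8 (i) p.18] -/
theorem kernelSetting_not_p18_i : ¬ kernelSetting.P18_i := by
  intro h
  have hinj := h 3 Nat.prime_three le_rfl trivial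
  have h01 : (Multiplicative.ofAdd (0 : ZMod 2) : kernelSetting.AutBar) =
      Multiplicative.ofAdd (1 : ZMod 2) := hinj (addMonoidEnd_punit_eq _ _)
  have hne : (0 : ZMod 2) ≠ 1 := by decide
  exact hne (Multiplicative.ofAdd.injective h01)

/-- **(v) is false at `kernelSetting`**: the model `kernelSetting.model` has rational `3`-torsion but
the semi-stable-reduction predicate is identically `False`. [cite: Mochizuki2012, IUTchIV Prop 1.8 (v) p.19] -/
theorem kernelSetting_not_p18_v : ¬ kernelSetting.P18_v := fun h =>
  h 3 Nat.prime_three le_rfl trivial kernelSetting.model (kernelSetting.torsionRational 3)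

/-- **(vi) is false at `kernelSetting`**: `#Aut_k̄(E_k̄) = 2`, `G_E = G_k`, `ρ_2` trivial, yet no model
"in Legendre form" exists (the predicate is identically `False`).
[cite: Mochizuki2012, IUTchIV Prop 1.8 (vi) p.19] -/
theorem kernelSetting_not_p18_vi : ¬ kernelSetting.P18_vi := by
  intro h
  have hGE : kernelSetting.GE = ⊤ := Subsingleton.elim _ _
  obtain ⟨s, hs, -⟩ := h kernelSetting_card_autBar trivial hGE (fun _ => addMonoidEnd_punit_eq _ _)
  exact hs

/-- **The conjunction `P18` is false at `kernelSetting`.** [cite: Mochizuki2012, IUTchIV Prop 1.8 pp.18-19] -/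
theorem kernelSetting_not_p18 : ¬ kernelSetting.P18 := fun h => kernelSetting_not_p18_i h.1

/-! ## A counter-instance for (vii): "inertia" acting by a sign under a vacuous good-reduction predicate -/

/-- The sign representation `ℤ/2 → End(ℤ/3)`, `g ↦ (−1)^g`. [cite: Mochizuki2012, IUTchIV Prop 1.8 (vii) p.19] -/
def signRep : Multiplicative (ZMod 2) →* AddMonoid.End (ZMod 3) where
  toFun g := (-1) ^ (Multiplicative.toAdd g).val
  map_one' := by simp
  map_mul' a b := by
    change (-1 : AddMonoid.End (ZMod 3)) ^ (Multiplicative.toAdd a + Multiplicative.toAdd b).val = _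
    rw [ZMod.val_add, ← neg_one_pow_eq_pow_mod_two, pow_add]

/-- The generator of `ℤ/2` acts by `−1`: on `1 ∈ ℤ/3` the sign representation gives `−1`.
[cite: Mochizuki2012, IUTchIV Prop 1.8 (vii) p.19] -/
theorem signRep_ofAdd_one_apply_one :
    signRep (Multiplicative.ofAdd (1 : ZMod 2)) (1 : ZMod 3) = -1 := by
  have hval : (Multiplicative.toAdd (Multiplicative.ofAdd (1 : ZMod 2))).val = 1 := by
    rw [toAdd_ofAdd]
    exact ZMod.val_one 2
  show ((-1 : AddMonoid.End (ZMod 3)) ^ (Multiplicative.toAdd (Multiplicative.ofAdd (1 : ZMod 2))).val)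
      (1 : ZMod 3) = -1
  rw [hval, pow_one]
  rfl

/-- A DEGENERATE instance of the lawless interface: `G_k = I_k = ℤ/2 = Aut_k(E_k̄)` (discrete),
`Aut_k̄(E_k̄) = 1`, every torsion module `ℤ/3` with `ρ_n` the sign representation, and the
good-reduction predicate identically `True`. [cite: Mochizuki2012, IUTchIV Prop 1.8 (vii) p.19] -/
abbrev signSetting : TorsionSetting where
  Gk := Multiplicative (ZMod 2)
  instGroupGk := inferInstance
  instTopGk := ⊥
  AutBar := PUnit.{1}
  instGroupAutBar := inferInstance
  AutK := Multiplicative (ZMod 2)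
  instGroupAutK := inferInstance
  incl := 1
  proj := MonoidHom.id _
  Tor := fun _ => ZMod 3
  instTor := fun _ => inferInstance
  ρ := fun _ => signRep
  charUnitK := fun _ => True
  charUnitO := fun _ => True
  charUnitO_le := fun _ h => h
  Gj := ⊤
  inertia := ⊤
  wildInertia := ⊤
  wild_le := le_rfl
  SemistableReduction := fun _ _ => True
  GoodReduction := fun _ _ => True
  MultiplicativeReduction := fun _ _ => False
  IsLegendre := fun _ => True

/-- The identity section is a model over `k` in `signSetting`. [cite: Mochizuki2012, IUTchIV Prop 1.8 pp.18-19] -/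
def signSetting.model : signSetting.Model ⊤ := ⟨(⊤ : Subgroup signSetting.Gk).subtype, fun _ => rfl⟩

/-- **(vii) is false at `signSetting`**: the model has "good reduction" (vacuously) but the element
`1 ∈ ℤ/2 = I_k` acts on the `3`-"torsion" `ℤ/3` by `−1 ≠ 1`. [cite: Mochizuki2012, IUTchIV Prop 1.8 (vii) p.19] -/
theorem signSetting_not_p18_vii : ¬ signSetting.P18_vii := by
  intro h
  have h1 : signSetting.torsionAction signSetting.model 3
      ⟨Multiplicative.ofAdd (1 : ZMod 2), Subgroup.mem_top _⟩ = 1 :=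
    (h 3 (by norm_num) trivial signSetting.model).1 trivial (Multiplicative.ofAdd (1 : ZMod 2))
      (Subgroup.mem_top _)
  have h1' : signRep (Multiplicative.ofAdd (1 : ZMod 2)) = 1 := h1
  have h2 := congrArg (fun f : AddMonoid.End (ZMod 3) => f (1 : ZMod 3)) h1'
  simp only [signRep_ofAdd_one_apply_one] at h2
  -- `h2 : -1 = (1 : AddMonoid.End (ZMod 3)) 1`, i.e. `-1 = 1` in `ℤ/3`
  have h3 : (-1 : ZMod 3) = 1 := h2
  exact absurd h3 (by decide)

/-! ## The FACT-LIST statements: the universal closures are false -/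

/-- **Row F-2259**: `¬ ∀ S, S.P18_i`. [cite: Mochizuki2012, IUTchIV Prop 1.8 (i) p.18] -/
theorem not_forall_p18_i : ¬ ∀ S : TorsionSetting, S.P18_i := fun h => kernelSetting_not_p18_i (h _)

/-- **Row F-2260**: `¬ ∀ S, S.P18_v`. [cite: Mochizuki2012, IUTchIV Prop 1.8 (v) p.19] -/
theorem not_forall_p18_v : ¬ ∀ S : TorsionSetting, S.P18_v := fun h => kernelSetting_not_p18_v (h _)

/-- **Row F-2261**: `¬ ∀ S, S.P18_vi`. [cite: Mochizuki2012, IUTchIV Prop 1.8 (vi) p.19] -/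
theorem not_forall_p18_vi : ¬ ∀ S : TorsionSetting, S.P18_vi := fun h => kernelSetting_not_p18_vi (h _)

/-- **Row F-2262**: `¬ ∀ S, S.P18_vii`. [cite: Mochizuki2012, IUTchIV Prop 1.8 (vii) p.19] -/
theorem not_forall_p18_vii : ¬ ∀ S : TorsionSetting, S.P18_vii :=
  fun h => signSetting_not_p18_vii (h _)

/-- **Row F-2258**: `¬ ∀ S, S.P18` — while `∃ S, S.P18` (`exists_p18`): the conjunction of
[IUTchIV] Prop. 1.8 (i)–(vii) over the interface is a satisfiable, non-tautological SCHEMA, to be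
consumed only at a named instance. [cite: Mochizuki2012, IUTchIV Prop 1.8 pp.18-19] -/
theorem not_forall_p18 : ¬ ∀ S : TorsionSetting, S.P18 := fun h => kernelSetting_not_p18 (h _)

end TorsionSetting

end Prop18

end Literature.IUT.LogVolume
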